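/-
COR-CM (cell pub-hodgecm2, stage 2 of the Hodge ladder) — count-neutral KERNEL CENSUS TRANSPORT, INTRINSIC FORM, degree 12, type `D₆`
(seat prover-pub-hodgecm2-b23-g33-0, binder prover b23, gen 33; claim INT2-INTRINSIC addendum DEG12-GENERATORS; sequel of
`Census/DuodecicFaceTransportDihedral.lean` and `CorCM/FaceCensusGroupDictionary.lean`). Theorems only; no definition, no named fact, nothing
asserted; the census dictionary (`enum`, `group_spec` of `Census/DuodecicFaceGeneratorsDihedral.lean`) is consumed BY NAME; `Interfaces.lean` (C1), every E
term, B01 and `Transposition/*` are untouched. HONEST FRAMING (COORDINATOR RULING — HODGE FRAMING CORRECTION, 2026-08-21T11:55:35Z): `HC_CM` is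
NOT proved, here or anywhere in the tree. Every closing theorem below is CONDITIONAL on face-period witnesses (for ONE field, on the listed faces);
no period is proved here.
T5 (coordinator ruling 15:33:56Z (3), lead staging l.4095): the DICTIONARY binders of `…_duodecicDihedral_aut` (`ε`, `hε`, `c`, `hc`, `ε c = Γ.conj`) are
DISCHARGED here from ONE isomorphism `e : Gal(K/ℚ) ≃* DihedralGroup 6`; the face-reading
binders are inhabited in the kernel (`exists_face_<code>_of_mulEquiv`); the only remaining hypotheses are the period witnesses on the listed faces =
instances of the crux (`FacePeriodExists` / B01-S), against which the tree has no `¬` theorem on the universe of record — no contradiction derivable;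
checker: self (prover-pub-hodgecm2-b23-g33-0), 2026-08-21.
-/
import Summits.HodgeConjecture.CorCM.FaceCensusGroupDictionary
import Summits.HodgeConjecture.CorCM.Census.DuodecicFaceTransportDihedral
import Mathlib.GroupTheory.SpecificGroups.Dihedral
import HarnessLib

/-!
# Galois CM fields of degree 12 with group `D₆`: field closure from an isomorphism with the Mathlib group (intrinsic form)

Fields of this type: the Galois closures `L = k·F̃₀` of the sextic CM fields `K₀ = k·F₀` (`k` imaginary quadratic, `F₀` a NON-Galois totally real cubic): `Gal(L/ℚ) ≅ C₂ × S₃ ≅ D₆` with complex conjugation the central `r 3` — the commonest sextic CM fields, OUTSIDE the closure-degree-24/48 regime of the stage-1 statement `PerL`.  The automorphism-form field-closure theorem `…_duodecicDihedral_aut` (`Census/DuodecicFaceTransportDihedral.lean`) takes an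
enumeration `ε : Aut(K) ≃ Fin 12` multiplicative for the census table, the conjugation automorphism `c` at `σ₀` and `ε c = Γ.conj` as
hypotheses.  Here all of it is derived from ONE isomorphism `e : Gal(K/ℚ) ≃* DihedralGroup 6` (`FaceCensus.exists_enum_of_groupEnum` over the
certified dictionary `group_spec`); complex conjugation reads `Γ.conj` because complex conjugation is a CENTRAL involution `≠ 1` of `Gal(K/ℚ)` (`K` is CM: `FaceCensus.conjAut_comm`), and `r 3` is the only central involution of `D₆`.  The 8 generating
faces of the census (minimal number of face ORBITS for this type by the exact model, kit job j137010) then read as explicit group data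
(`…_mulEquiv`), and they exist for every such `K`, `e`, `σ₀` (`exists_face_<code>_of_mulEquiv`).  `HC_CM` is NOT proved and nothing here
produces a period.

References: [cite: Pohlmann1968, Thm. 1]; [cite: Milne1999LefschetzClasses, Thm. 3.2 and Cor. 4.5];
[cite: Shimura1998, §6.2 Theorem 3 and §6.1 Corollary of Theorem 2 (pp. 41–43)]; [cite: MumfordAV1970, §19 Thm. 1 and p. 169].
-/

noncomputable section

open CategoryTheory NumberField NumberField.ComplexEmbedding
open Literature.AlgebraicGeometry Literature.AlgebraicGeometry.Motives Literature.AlgebraicGeometry.HodgeTheory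
open Literature.AlgebraicGeometry.ComplexMultiplication Literature.AlgebraicGeometry.Milne1999
open Literature.NumberTheory.Automorphic
open Literature.NumberTheory.Automorphic.PicardCM
open Summit.HodgeConjecture.CorCM.Domination

namespace Summit.HodgeConjecture.CorCM.DuodecicFaceTransport.Dihedral

open Summit.HodgeConjecture.CorCM.Census.FaceSquaresModel (mem)
open Summit.HodgeConjecture.CorCM.Census.DuodecicFaceGeneratorsDihedral (Γ enum group_spec)

/-- `DihedralGroup 6`: the only CENTRAL involution is `r 3`. [folklore] -/
theorem central_involution_eq :
    ∀ x : DihedralGroup 6, x ≠ 1 → x * x = 1 → (∀ y, x * y = y * x) → x = DihedralGroup.r 3 := by decide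

/-- **The dictionary from an isomorphism with `DihedralGroup 6`, type `D₆`.**  `K` a Galois CM field, `e : Gal(K/ℚ) ≃* DihedralGroup 6`, `σ₀` a base
embedding.  Then there is an enumeration `ε : Aut(K) ≃ Fin 12`, multiplicative for the Cayley table of `Census/DuodecicFaceGeneratorsDihedral.lean`, reading `e`
through `enum`, under which THE automorphism inducing complex conjugation at `σ₀` reads `Γ.conj` — proved, not assumed: complex conjugation is a CENTRAL involution `≠ 1` of `Gal(K/ℚ)` (`K` is CM: `FaceCensus.conjAut_comm`), and `r 3` is the only central involution of `D₆`. [folklore] -/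
theorem exists_autEnum_of_mulEquiv (K : CMField) [IsGalois ℚ K] (e : ((K : Type) ≃ₐ[ℚ] (K : Type)) ≃* DihedralGroup 6) (σ₀ : (K : Type) →+* ℂ) :
    ∃ ε : ((K : Type) ≃ₐ[ℚ] (K : Type)) ≃ Fin 12,
      (∀ x y : ((K : Type) ≃ₐ[ℚ] (K : Type)), ε (x * y) = Γ.mul (ε x) (ε y)) ∧ (∀ h : ((K : Type) ≃ₐ[ℚ] (K : Type)), enum (ε h) = e h) ∧
      (∀ (h : ((K : Type) ≃ₐ[ℚ] (K : Type))) (i : Fin 12), e h = enum i → ε h = i) ∧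
      ∀ c : ((K : Type) ≃ₐ[ℚ] (K : Type)), σ₀.comp (c : (K : Type) →+* (K : Type)) = conjugate σ₀ → ε c = Γ.conj := by
  obtain ⟨ε, hε, hread⟩ := FaceCensus.exists_enum_of_groupEnum Γ (· * ·) enum group_spec.2.1 group_spec.2.2.1
    (by rw [DihedralGroup.card]) e e.bijective (map_mul e)
  refine ⟨ε, hε, hread, fun h i hh => group_spec.2.2.1 ((hread h).trans hh), fun c hc => group_spec.2.2.1 ?_⟩
  rw [hread, group_spec.2.2.2]
  exact central_involution_eq _ ((MulEquiv.map_ne_one_iff e).mpr (FaceCensus.conjAut_ne_one σ₀ hc))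
      (by rw [← map_mul, FaceCensus.conjAut_mul_self σ₀ hc, map_one])
      (fun y => by
        obtain ⟨x, rfl⟩ := e.surjective y
        rw [← map_mul, ← map_mul, FaceCensus.conjAut_comm σ₀ hc x])

/-- The base type of code `455`, read in `DihedralGroup 6`. [folklore] -/
theorem mem_455_iff_enum : ∀ i : Fin 12, mem i 455 = true ↔ enum i ∈ ({DihedralGroup.r 0, DihedralGroup.r 1, DihedralGroup.r 2, DihedralGroup.sr 0, DihedralGroup.sr 1, DihedralGroup.sr 2} : Finset (DihedralGroup 6)) := by
  decide

/-- The base type of code `462`, read in `DihedralGroup 6`. [folklore] -/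
theorem mem_462_iff_enum : ∀ i : Fin 12, mem i 462 = true ↔ enum i ∈ ({DihedralGroup.r 1, DihedralGroup.r 2, DihedralGroup.r 3, DihedralGroup.sr 0, DihedralGroup.sr 1, DihedralGroup.sr 2} : Finset (DihedralGroup 6)) := by
  decide

/-- The base type of code `469`, read in `DihedralGroup 6`. [folklore] -/
theorem mem_469_iff_enum : ∀ i : Fin 12, mem i 469 = true ↔ enum i ∈ ({DihedralGroup.r 0, DihedralGroup.r 2, DihedralGroup.r 4, DihedralGroup.sr 0, DihedralGroup.sr 1, DihedralGroup.sr 2} : Finset (DihedralGroup 6)) := by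
  decide

/-- **Non-vacuity for the base type of code `455`, type `D₆`.**  For every two group elements `x, y` at different places (`y ≠ x`,
`y ≠ c·x`) there is a rank-four face with base type `Φ` reading `σ₀ ∘ h ∈ Φ ↔ e h ∈ {r 0, r 1, r 2, sr 0, sr 1, sr 2}` and place
representatives `σ₀ ∘ e⁻¹(x)`, `σ₀ ∘ e⁻¹(y)`. [folklore] -/
theorem exists_face_455_of_mulEquiv (K : CMField) [IsGalois ℚ K] (e : ((K : Type) ≃ₐ[ℚ] (K : Type)) ≃* DihedralGroup 6) (σ₀ : (K : Type) →+* ℂ)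
    (x y : DihedralGroup 6) (hxy : x ≠ y ∧ DihedralGroup.r 3 * x ≠ y) :
    ∃ R : Face K, (∀ h : ((K : Type) ≃ₐ[ℚ] (K : Type)), σ₀.comp (h : (K : Type) →+* (K : Type)) ∈ R.Φ.1 ↔ e h ∈ ({DihedralGroup.r 0, DihedralGroup.r 1, DihedralGroup.r 2, DihedralGroup.sr 0, DihedralGroup.sr 1, DihedralGroup.sr 2} : Finset (DihedralGroup 6))) ∧
      R.p = σ₀.comp ((e.symm x : ((K : Type) ≃ₐ[ℚ] (K : Type))) : (K : Type) →+* (K : Type)) ∧ R.p' = σ₀.comp ((e.symm y : ((K : Type) ≃ₐ[ℚ] (K : Type))) : (K : Type) →+* (K : Type)) := by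
  obtain ⟨ε, hε, hread, hidx, hconj⟩ := exists_autEnum_of_mulEquiv K e σ₀
  obtain ⟨c, hc⟩ := FaceCensus.exists_conjAut σ₀
  obtain ⟨e', hmul, he⟩ := FaceCensus.exists_enum_of_autEnum Γ σ₀ ε hε
  have hconj' : e' conjT = Γ.conj := by rw [FaceCensus.conjT_eq_translate σ₀, ← hc, he, hconj c hc]
  obtain ⟨R₀, hT₀, -, -⟩ := FaceCensus.exists_face_reads Γ e' hmul hconj' σ₀ (r := (455, 9, 18)) (by decide +kernel)
  have hne : InfinitePlace.mk (σ₀.comp ((e.symm x : ((K : Type) ≃ₐ[ℚ] (K : Type))) : (K : Type) →+* (K : Type))) ≠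
      InfinitePlace.mk (σ₀.comp ((e.symm y : ((K : Type) ≃ₐ[ℚ] (K : Type))) : (K : Type) →+* (K : Type))) := by
    rw [Ne, FaceCensus.mk_comp_eq_mk_comp_iff σ₀ hc]
    rintro (h | h)
    · exact hxy.1 (by simpa using congrArg e h)
    · refine hxy.2 ?_
      have h2 := congrArg e h
      simp only [map_mul, MulEquiv.apply_symm_apply] at h2
      rw [← h2, ← group_spec.2.2.2, ← hread, hconj c hc]
  refine ⟨⟨R₀.Φ, _, _, hne⟩, fun h => ?_, rfl, rfl⟩
  have hk := hT₀.2 (e' (translate σ₀ (σ₀.comp (h : (K : Type) →+* (K : Type)))))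
  rw [e'.symm_apply_apply, mem_pullType, translate_apply_self, he] at hk
  rw [← hread h]
  exact hk.symm.trans (mem_455_iff_enum (ε h))

/-- **Non-vacuity for the base type of code `462`, type `D₆`.**  For every two group elements `x, y` at different places (`y ≠ x`,
`y ≠ c·x`) there is a rank-four face with base type `Φ` reading `σ₀ ∘ h ∈ Φ ↔ e h ∈ {r 1, r 2, r 3, sr 0, sr 1, sr 2}` and place
representatives `σ₀ ∘ e⁻¹(x)`, `σ₀ ∘ e⁻¹(y)`. [folklore] -/
theorem exists_face_462_of_mulEquiv (K : CMField) [IsGalois ℚ K] (e : ((K : Type) ≃ₐ[ℚ] (K : Type)) ≃* DihedralGroup 6) (σ₀ : (K : Type) →+* ℂ)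
    (x y : DihedralGroup 6) (hxy : x ≠ y ∧ DihedralGroup.r 3 * x ≠ y) :
    ∃ R : Face K, (∀ h : ((K : Type) ≃ₐ[ℚ] (K : Type)), σ₀.comp (h : (K : Type) →+* (K : Type)) ∈ R.Φ.1 ↔ e h ∈ ({DihedralGroup.r 1, DihedralGroup.r 2, DihedralGroup.r 3, DihedralGroup.sr 0, DihedralGroup.sr 1, DihedralGroup.sr 2} : Finset (DihedralGroup 6))) ∧
      R.p = σ₀.comp ((e.symm x : ((K : Type) ≃ₐ[ℚ] (K : Type))) : (K : Type) →+* (K : Type)) ∧ R.p' = σ₀.comp ((e.symm y : ((K : Type) ≃ₐ[ℚ] (K : Type))) : (K : Type) →+* (K : Type)) := by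
  obtain ⟨ε, hε, hread, hidx, hconj⟩ := exists_autEnum_of_mulEquiv K e σ₀
  obtain ⟨c, hc⟩ := FaceCensus.exists_conjAut σ₀
  obtain ⟨e', hmul, he⟩ := FaceCensus.exists_enum_of_autEnum Γ σ₀ ε hε
  have hconj' : e' conjT = Γ.conj := by rw [FaceCensus.conjT_eq_translate σ₀, ← hc, he, hconj c hc]
  obtain ⟨R₀, hT₀, -, -⟩ := FaceCensus.exists_face_reads Γ e' hmul hconj' σ₀ (r := (462, 36, 1152)) (by decide +kernel)
  have hne : InfinitePlace.mk (σ₀.comp ((e.symm x : ((K : Type) ≃ₐ[ℚ] (K : Type))) : (K : Type) →+* (K : Type))) ≠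
      InfinitePlace.mk (σ₀.comp ((e.symm y : ((K : Type) ≃ₐ[ℚ] (K : Type))) : (K : Type) →+* (K : Type))) := by
    rw [Ne, FaceCensus.mk_comp_eq_mk_comp_iff σ₀ hc]
    rintro (h | h)
    · exact hxy.1 (by simpa using congrArg e h)
    · refine hxy.2 ?_
      have h2 := congrArg e h
      simp only [map_mul, MulEquiv.apply_symm_apply] at h2
      rw [← h2, ← group_spec.2.2.2, ← hread, hconj c hc]
  refine ⟨⟨R₀.Φ, _, _, hne⟩, fun h => ?_, rfl, rfl⟩
  have hk := hT₀.2 (e' (translate σ₀ (σ₀.comp (h : (K : Type) →+* (K : Type)))))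
  rw [e'.symm_apply_apply, mem_pullType, translate_apply_self, he] at hk
  rw [← hread h]
  exact hk.symm.trans (mem_462_iff_enum (ε h))

/-- **Non-vacuity for the base type of code `469`, type `D₆`.**  For every two group elements `x, y` at different places (`y ≠ x`,
`y ≠ c·x`) there is a rank-four face with base type `Φ` reading `σ₀ ∘ h ∈ Φ ↔ e h ∈ {r 0, r 2, r 4, sr 0, sr 1, sr 2}` and place
representatives `σ₀ ∘ e⁻¹(x)`, `σ₀ ∘ e⁻¹(y)`. [folklore] -/
theorem exists_face_469_of_mulEquiv (K : CMField) [IsGalois ℚ K] (e : ((K : Type) ≃ₐ[ℚ] (K : Type)) ≃* DihedralGroup 6) (σ₀ : (K : Type) →+* ℂ)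
    (x y : DihedralGroup 6) (hxy : x ≠ y ∧ DihedralGroup.r 3 * x ≠ y) :
    ∃ R : Face K, (∀ h : ((K : Type) ≃ₐ[ℚ] (K : Type)), σ₀.comp (h : (K : Type) →+* (K : Type)) ∈ R.Φ.1 ↔ e h ∈ ({DihedralGroup.r 0, DihedralGroup.r 2, DihedralGroup.r 4, DihedralGroup.sr 0, DihedralGroup.sr 1, DihedralGroup.sr 2} : Finset (DihedralGroup 6))) ∧
      R.p = σ₀.comp ((e.symm x : ((K : Type) ≃ₐ[ℚ] (K : Type))) : (K : Type) →+* (K : Type)) ∧ R.p' = σ₀.comp ((e.symm y : ((K : Type) ≃ₐ[ℚ] (K : Type))) : (K : Type) →+* (K : Type)) := by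
  obtain ⟨ε, hε, hread, hidx, hconj⟩ := exists_autEnum_of_mulEquiv K e σ₀
  obtain ⟨c, hc⟩ := FaceCensus.exists_conjAut σ₀
  obtain ⟨e', hmul, he⟩ := FaceCensus.exists_enum_of_autEnum Γ σ₀ ε hε
  have hconj' : e' conjT = Γ.conj := by rw [FaceCensus.conjT_eq_translate σ₀, ← hc, he, hconj c hc]
  obtain ⟨R₀, hT₀, -, -⟩ := FaceCensus.exists_face_reads Γ e' hmul hconj' σ₀ (r := (469, 9, 36)) (by decide +kernel)
  have hne : InfinitePlace.mk (σ₀.comp ((e.symm x : ((K : Type) ≃ₐ[ℚ] (K : Type))) : (K : Type) →+* (K : Type))) ≠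
      InfinitePlace.mk (σ₀.comp ((e.symm y : ((K : Type) ≃ₐ[ℚ] (K : Type))) : (K : Type) →+* (K : Type))) := by
    rw [Ne, FaceCensus.mk_comp_eq_mk_comp_iff σ₀ hc]
    rintro (h | h)
    · exact hxy.1 (by simpa using congrArg e h)
    · refine hxy.2 ?_
      have h2 := congrArg e h
      simp only [map_mul, MulEquiv.apply_symm_apply] at h2
      rw [← h2, ← group_spec.2.2.2, ← hread, hconj c hc]
  refine ⟨⟨R₀.Φ, _, _, hne⟩, fun h => ?_, rfl, rfl⟩
  have hk := hT₀.2 (e' (translate σ₀ (σ₀.comp (h : (K : Type) →+* (K : Type)))))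
  rw [e'.symm_apply_apply, mem_pullType, translate_apply_self, he] at hk
  rw [← hread h]
  exact hk.symm.trans (mem_469_iff_enum (ε h))

/-- **FIELD CLOSURE FROM `Gal(K/ℚ) ≃* DihedralGroup 6`, type `D₆` — CLOSED, headline.**  `K` a Galois CM field with an isomorphism
`e : Gal(K/ℚ) ≃* DihedralGroup 6` (so `[K:ℚ] = 12`), complex conjugation read off `e` automatically; `σ₀` a base embedding; the 8 faces `R₁`: type `455` ↔ `{r 0, r 1, r 2, sr 0, sr 1, sr 2}`, places `e⁻¹(r 0)`, `e⁻¹(r 1)`; `R₂`: type `455` ↔ `{r 0, r 1, r 2, sr 0, sr 1, sr 2}`, places `e⁻¹(r 0)`, `e⁻¹(r 2)`; `R₃`: type `455` ↔ `{r 0, r 1, r 2, sr 0, sr 1, sr 2}`, places `e⁻¹(r 0)`, `e⁻¹(sr 0)`; `R₄`: type `455` ↔ `{r 0, r 1, r 2, sr 0, sr 1, sr 2}`, places `e⁻¹(r 0)`, `e⁻¹(sr 1)`; `R₅`: type `455` ↔ `{r 0, r 1, r 2, sr 0, sr 1, sr 2}`, places `e⁻¹(r 1)`, `e⁻¹(r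 2)`; `R₆`: type `455` ↔ `{r 0, r 1, r 2, sr 0, sr 1, sr 2}`, places `e⁻¹(r 1)`, `e⁻¹(sr 1)`; `R₇`: type `462` ↔ `{r 1, r 2, r 3, sr 0, sr 1, sr 2}`, places `e⁻¹(r 2)`, `e⁻¹(sr 1)`; `R₈`: type `469` ↔ `{r 0, r 2, r 4, sr 0, sr 1, sr 2}`, places `e⁻¹(r 0)`, `e⁻¹(r 2)` (they exist:
`exists_face_<code>_of_mulEquiv`).  ONE period witness for each on the universe of record implies the Hodge conjecture, in every codimension,
for every complex abelian variety dominated by a finite product of abelian varieties realising CM types of CM fields embeddable in `K`.  No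
enumeration, table or conjugation-index hypothesis is left (`exists_autEnum_of_mulEquiv`).  (FRAMING: conditional on these 8 face periods;
`HC_CM` is NOT proved.) [cite: Shimura1998, §6.2 Theorem 3 and §6.1 Corollary of Theorem 2 (pp. 41–43)] [cite: Pohlmann1968, Thm. 1]
[cite: Milne1999LefschetzClasses, Thm. 3.2 and Cor. 4.5] [cite: MumfordAV1970, §19 Thm. 1 and p. 169] -/
theorem hodgeConjectureFor_of_avDominatedBy_isProductOf_of_facePeriod_duodecicDihedral_mulEquiv (K : CMField) [IsGalois ℚ K]
    (e : ((K : Type) ≃ₐ[ℚ] (K : Type)) ≃* DihedralGroup 6) (σ₀ : (K : Type) →+* ℂ) (R₁ R₂ R₃ R₄ R₅ R₆ R₇ R₈ : Face K)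
    (hΦ₁ : ∀ h : ((K : Type) ≃ₐ[ℚ] (K : Type)), σ₀.comp (h : (K : Type) →+* (K : Type)) ∈ R₁.Φ.1 ↔ e h ∈ ({DihedralGroup.r 0, DihedralGroup.r 1, DihedralGroup.r 2, DihedralGroup.sr 0, DihedralGroup.sr 1, DihedralGroup.sr 2} : Finset (DihedralGroup 6)))
    (hp₁ : R₁.p = σ₀.comp ((e.symm (DihedralGroup.r 0) : ((K : Type) ≃ₐ[ℚ] (K : Type))) : (K : Type) →+* (K : Type)))
    (hq₁ : R₁.p' = σ₀.comp ((e.symm (DihedralGroup.r 1) : ((K : Type) ≃ₐ[ℚ] (K : Type))) : (K : Type) →+* (K : Type)))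
    (hΦ₂ : ∀ h : ((K : Type) ≃ₐ[ℚ] (K : Type)), σ₀.comp (h : (K : Type) →+* (K : Type)) ∈ R₂.Φ.1 ↔ e h ∈ ({DihedralGroup.r 0, DihedralGroup.r 1, DihedralGroup.r 2, DihedralGroup.sr 0, DihedralGroup.sr 1, DihedralGroup.sr 2} : Finset (DihedralGroup 6)))
    (hp₂ : R₂.p = σ₀.comp ((e.symm (DihedralGroup.r 0) : ((K : Type) ≃ₐ[ℚ] (K : Type))) : (K : Type) →+* (K : Type)))
    (hq₂ : R₂.p' = σ₀.comp ((e.symm (DihedralGroup.r 2) : ((K : Type) ≃ₐ[ℚ] (K : Type))) : (K : Type) →+* (K : Type)))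
    (hΦ₃ : ∀ h : ((K : Type) ≃ₐ[ℚ] (K : Type)), σ₀.comp (h : (K : Type) →+* (K : Type)) ∈ R₃.Φ.1 ↔ e h ∈ ({DihedralGroup.r 0, DihedralGroup.r 1, DihedralGroup.r 2, DihedralGroup.sr 0, DihedralGroup.sr 1, DihedralGroup.sr 2} : Finset (DihedralGroup 6)))
    (hp₃ : R₃.p = σ₀.comp ((e.symm (DihedralGroup.r 0) : ((K : Type) ≃ₐ[ℚ] (K : Type))) : (K : Type) →+* (K : Type)))
    (hq₃ : R₃.p' = σ₀.comp ((e.symm (DihedralGroup.sr 0) : ((K : Type) ≃ₐ[ℚ] (K : Type))) : (K : Type) →+* (K : Type)))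
    (hΦ₄ : ∀ h : ((K : Type) ≃ₐ[ℚ] (K : Type)), σ₀.comp (h : (K : Type) →+* (K : Type)) ∈ R₄.Φ.1 ↔ e h ∈ ({DihedralGroup.r 0, DihedralGroup.r 1, DihedralGroup.r 2, DihedralGroup.sr 0, DihedralGroup.sr 1, DihedralGroup.sr 2} : Finset (DihedralGroup 6)))
    (hp₄ : R₄.p = σ₀.comp ((e.symm (DihedralGroup.r 0) : ((K : Type) ≃ₐ[ℚ] (K : Type))) : (K : Type) →+* (K : Type)))
    (hq₄ : R₄.p' = σ₀.comp ((e.symm (DihedralGroup.sr 1) : ((K : Type) ≃ₐ[ℚ] (K : Type))) : (K : Type) →+* (K : Type)))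
    (hΦ₅ : ∀ h : ((K : Type) ≃ₐ[ℚ] (K : Type)), σ₀.comp (h : (K : Type) →+* (K : Type)) ∈ R₅.Φ.1 ↔ e h ∈ ({DihedralGroup.r 0, DihedralGroup.r 1, DihedralGroup.r 2, DihedralGroup.sr 0, DihedralGroup.sr 1, DihedralGroup.sr 2} : Finset (DihedralGroup 6)))
    (hp₅ : R₅.p = σ₀.comp ((e.symm (DihedralGroup.r 1) : ((K : Type) ≃ₐ[ℚ] (K : Type))) : (K : Type) →+* (K : Type)))
    (hq₅ : R₅.p' = σ₀.comp ((e.symm (DihedralGroup.r 2) : ((K : Type) ≃ₐ[ℚ] (K : Type))) : (K : Type) →+* (K : Type)))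
    (hΦ₆ : ∀ h : ((K : Type) ≃ₐ[ℚ] (K : Type)), σ₀.comp (h : (K : Type) →+* (K : Type)) ∈ R₆.Φ.1 ↔ e h ∈ ({DihedralGroup.r 0, DihedralGroup.r 1, DihedralGroup.r 2, DihedralGroup.sr 0, DihedralGroup.sr 1, DihedralGroup.sr 2} : Finset (DihedralGroup 6)))
    (hp₆ : R₆.p = σ₀.comp ((e.symm (DihedralGroup.r 1) : ((K : Type) ≃ₐ[ℚ] (K : Type))) : (K : Type) →+* (K : Type)))
    (hq₆ : R₆.p' = σ₀.comp ((e.symm (DihedralGroup.sr 1) : ((K : Type) ≃ₐ[ℚ] (K : Type))) : (K : Type) →+* (K : Type)))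
    (hΦ₇ : ∀ h : ((K : Type) ≃ₐ[ℚ] (K : Type)), σ₀.comp (h : (K : Type) →+* (K : Type)) ∈ R₇.Φ.1 ↔ e h ∈ ({DihedralGroup.r 1, DihedralGroup.r 2, DihedralGroup.r 3, DihedralGroup.sr 0, DihedralGroup.sr 1, DihedralGroup.sr 2} : Finset (DihedralGroup 6)))
    (hp₇ : R₇.p = σ₀.comp ((e.symm (DihedralGroup.r 2) : ((K : Type) ≃ₐ[ℚ] (K : Type))) : (K : Type) →+* (K : Type)))
    (hq₇ : R₇.p' = σ₀.comp ((e.symm (DihedralGroup.sr 1) : ((K : Type) ≃ₐ[ℚ] (K : Type))) : (K : Type) →+* (K : Type)))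
    (hΦ₈ : ∀ h : ((K : Type) ≃ₐ[ℚ] (K : Type)), σ₀.comp (h : (K : Type) →+* (K : Type)) ∈ R₈.Φ.1 ↔ e h ∈ ({DihedralGroup.r 0, DihedralGroup.r 2, DihedralGroup.r 4, DihedralGroup.sr 0, DihedralGroup.sr 1, DihedralGroup.sr 2} : Finset (DihedralGroup 6)))
    (hp₈ : R₈.p = σ₀.comp ((e.symm (DihedralGroup.r 0) : ((K : Type) ≃ₐ[ℚ] (K : Type))) : (K : Type) →+* (K : Type)))
    (hq₈ : R₈.p' = σ₀.comp ((e.symm (DihedralGroup.r 2) : ((K : Type) ≃ₐ[ℚ] (K : Type))) : (K : Type) →+* (K : Type)))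
    (h₁ : ∃ ι₁ : K →+* ℂ, R₁.Admissible ι₁ ∧ ∃ (V : HermSpace3 K ι₁) (σ : K →+* ℂ),
      (Model.picardCMUniverse exists_isReal_hodgeModel_holds hodgePQ_independent_of_hodgeModel_holds
        BallQuotient.ballQuotientUniformised_holds cmAbelianVarietyRealised_holds).PeriodNV ι₁ V K R₁.psi σ)
    (h₂ : ∃ ι₁ : K →+* ℂ, R₂.Admissible ι₁ ∧ ∃ (V : HermSpace3 K ι₁) (σ : K →+* ℂ),
      (Model.picardCMUniverse exists_isReal_hodgeModel_holds hodgePQ_independent_of_hodgeModel_holds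
        BallQuotient.ballQuotientUniformised_holds cmAbelianVarietyRealised_holds).PeriodNV ι₁ V K R₂.psi σ)
    (h₃ : ∃ ι₁ : K →+* ℂ, R₃.Admissible ι₁ ∧ ∃ (V : HermSpace3 K ι₁) (σ : K →+* ℂ),
      (Model.picardCMUniverse exists_isReal_hodgeModel_holds hodgePQ_independent_of_hodgeModel_holds
        BallQuotient.ballQuotientUniformised_holds cmAbelianVarietyRealised_holds).PeriodNV ι₁ V K R₃.psi σ)
    (h₄ : ∃ ι₁ : K →+* ℂ, R₄.Admissible ι₁ ∧ ∃ (V : HermSpace3 K ι₁) (σ : K →+* ℂ),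
      (Model.picardCMUniverse exists_isReal_hodgeModel_holds hodgePQ_independent_of_hodgeModel_holds
        BallQuotient.ballQuotientUniformised_holds cmAbelianVarietyRealised_holds).PeriodNV ι₁ V K R₄.psi σ)
    (h₅ : ∃ ι₁ : K →+* ℂ, R₅.Admissible ι₁ ∧ ∃ (V : HermSpace3 K ι₁) (σ : K →+* ℂ),
      (Model.picardCMUniverse exists_isReal_hodgeModel_holds hodgePQ_independent_of_hodgeModel_holds
        BallQuotient.ballQuotientUniformised_holds cmAbelianVarietyRealised_holds).PeriodNV ι₁ V K R₅.psi σ)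
    (h₆ : ∃ ι₁ : K →+* ℂ, R₆.Admissible ι₁ ∧ ∃ (V : HermSpace3 K ι₁) (σ : K →+* ℂ),
      (Model.picardCMUniverse exists_isReal_hodgeModel_holds hodgePQ_independent_of_hodgeModel_holds
        BallQuotient.ballQuotientUniformised_holds cmAbelianVarietyRealised_holds).PeriodNV ι₁ V K R₆.psi σ)
    (h₇ : ∃ ι₁ : K →+* ℂ, R₇.Admissible ι₁ ∧ ∃ (V : HermSpace3 K ι₁) (σ : K →+* ℂ),
      (Model.picardCMUniverse exists_isReal_hodgeModel_holds hodgePQ_independent_of_hodgeModel_holds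
        BallQuotient.ballQuotientUniformised_holds cmAbelianVarietyRealised_holds).PeriodNV ι₁ V K R₇.psi σ)
    (h₈ : ∃ ι₁ : K →+* ℂ, R₈.Admissible ι₁ ∧ ∃ (V : HermSpace3 K ι₁) (σ : K →+* ℂ),
      (Model.picardCMUniverse exists_isReal_hodgeModel_holds hodgePQ_independent_of_hodgeModel_holds
        BallQuotient.ballQuotientUniformised_holds cmAbelianVarietyRealised_holds).PeriodNV ι₁ V K R₈.psi σ)
    {P A : AbelianVariety ℂ} (hP : AbelianVariety.IsProductOf (fun B : AbelianVariety ℂ =>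
      ∃ (E : Type) (_ : Field E) (_ : NumberField E) (_ : IsCMField E) (_ : E →+* (K : Type)) (Φ : CMType E)
        (ι : 𝓞 E →+* End B) (θ : E →+* Module.End ℂ (complexBetti B.X 1)),
        IsCMTypeRealisation Φ B ι θ) P)
    (hA : AVDominatedBy A P) : HodgeConjectureFor A.dim A.X := by
  obtain ⟨ε, hε, hread, hidx, hconj⟩ := exists_autEnum_of_mulEquiv K e σ₀
  obtain ⟨c, hc⟩ := FaceCensus.exists_conjAut σ₀
  refine hodgeConjectureFor_of_avDominatedBy_isProductOf_of_facePeriod_duodecicDihedral_aut K σ₀ ε hε c hc (hconj c hc) R₁ R₂ R₃ R₄ R₅ R₆ R₇ R₈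
    (e.symm (DihedralGroup.r 0)) (e.symm (DihedralGroup.r 1))
    (e.symm (DihedralGroup.r 0)) (e.symm (DihedralGroup.r 2))
    (e.symm (DihedralGroup.r 0)) (e.symm (DihedralGroup.sr 0))
    (e.symm (DihedralGroup.r 0)) (e.symm (DihedralGroup.sr 1))
    (e.symm (DihedralGroup.r 1)) (e.symm (DihedralGroup.r 2))
    (e.symm (DihedralGroup.r 1)) (e.symm (DihedralGroup.sr 1))
    (e.symm (DihedralGroup.r 2)) (e.symm (DihedralGroup.sr 1))
    (e.symm (DihedralGroup.r 0)) (e.symm (DihedralGroup.r 2))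
    ?_ ?_ ?_ ?_ ?_ ?_ ?_ ?_ ?_ ?_ ?_ ?_ ?_ ?_ ?_ ?_ ?_ ?_ ?_ ?_ ?_ ?_ ?_ ?_ ?_ ?_ ?_ ?_ ?_ ?_ ?_ ?_ ?_ ?_ ?_ ?_ ?_ ?_ ?_ ?_ h₁ h₂ h₃ h₄ h₅ h₆ h₇ h₈ hP hA
  · intro h
    rw [hΦ₁, ← hread h]
    exact (mem_455_iff_enum (ε h)).symm
  · exact hp₁
  · rw [hidx _ 0 (by rw [MulEquiv.apply_symm_apply]; decide)]; decide
  · exact hq₁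
  · rw [hidx _ 1 (by rw [MulEquiv.apply_symm_apply]; decide)]; decide
  · intro h
    rw [hΦ₂, ← hread h]
    exact (mem_455_iff_enum (ε h)).symm
  · exact hp₂
  · rw [hidx _ 0 (by rw [MulEquiv.apply_symm_apply]; decide)]; decide
  · exact hq₂
  · rw [hidx _ 2 (by rw [MulEquiv.apply_symm_apply]; decide)]; decide
  · intro h
    rw [hΦ₃, ← hread h]
    exact (mem_455_iff_enum (ε h)).symm
  · exact hp₃
  · rw [hidx _ 0 (by rw [MulEquiv.apply_symm_apply]; decide)]; decide
  · exact hq₃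
  · rw [hidx _ 6 (by rw [MulEquiv.apply_symm_apply]; decide)]; decide
  · intro h
    rw [hΦ₄, ← hread h]
    exact (mem_455_iff_enum (ε h)).symm
  · exact hp₄
  · rw [hidx _ 0 (by rw [MulEquiv.apply_symm_apply]; decide)]; decide
  · exact hq₄
  · rw [hidx _ 7 (by rw [MulEquiv.apply_symm_apply]; decide)]; decide
  · intro h
    rw [hΦ₅, ← hread h]
    exact (mem_455_iff_enum (ε h)).symm
  · exact hp₅
  · rw [hidx _ 1 (by rw [MulEquiv.apply_symm_apply]; decide)]; decide
  · exact hq₅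
  · rw [hidx _ 2 (by rw [MulEquiv.apply_symm_apply]; decide)]; decide
  · intro h
    rw [hΦ₆, ← hread h]
    exact (mem_455_iff_enum (ε h)).symm
  · exact hp₆
  · rw [hidx _ 1 (by rw [MulEquiv.apply_symm_apply]; decide)]; decide
  · exact hq₆
  · rw [hidx _ 7 (by rw [MulEquiv.apply_symm_apply]; decide)]; decide
  · intro h
    rw [hΦ₇, ← hread h]
    exact (mem_462_iff_enum (ε h)).symm
  · exact hp₇
  · rw [hidx _ 2 (by rw [MulEquiv.apply_symm_apply]; decide)]; decide
  · exact hq₇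
  · rw [hidx _ 7 (by rw [MulEquiv.apply_symm_apply]; decide)]; decide
  · intro h
    rw [hΦ₈, ← hread h]
    exact (mem_469_iff_enum (ε h)).symm
  · exact hp₈
  · rw [hidx _ 0 (by rw [MulEquiv.apply_symm_apply]; decide)]; decide
  · exact hq₈
  · rw [hidx _ 2 (by rw [MulEquiv.apply_symm_apply]; decide)]; decide

end Summit.HodgeConjecture.CorCM.DuodecicFaceTransport.Dihedral

end
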